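import Summits.KontsevichZagierPeriods.KontsevichZagierPeriods.Theorems.RootDecompZetaThreeFrontierRungFourPreludeP02

/-! # `RootDecompZetaThreeFrontierRungFourPreludeP03` — part 3/14 of the mechanical ≤400-line split of `pre_src.lean` (sha256 ba362a5194d75c20…)
Source: decomp-kz lens-1 g12/g13 rung-4 prelude = Prelude_v3.lean @ba362a51 (Basis22_v1 sections RotFour/Shuffle/ProdFour/GenFb/WordMoves/RungFour/Basis22 + FacetGeneric_v2 §1–§23; critic CLEARED g6 row 330 / g6-20 l.1368); --supports stmt-KontsevichZagierPeriods-27141.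
Split by census-1 g10 `gen/splitlean.py`: scopes re-opened with their `open`/`variable`/`set_option` context; mathematics and declaration order unchanged. -/

set_option linter.dupNamespace false
noncomputable section
namespace Summit.KontsevichZagierPeriods.KontsevichZagierPeriods.Cruxes.GZNormalFormWThree.GZLadder.Shuffle
open Set MeasureTheory
open Literature.NumberTheory.Transcendental
open Literature.ModelTheory.ExponentialFields
variable {n a b k : ℕ}

/-- the shuffle cell of `e`: tuples sorted decreasingly along `e` -/
def cell (e : Fin (a + b) ≃ Fin (a + b)) : Set (Fin (a + b) → ℝ) :=
  {z | (fun k => z (e k)) ∈ KZ.openOrderedSimplex (a + b)}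

/-- Auxiliary step `isSemialgebraic_cell`: is Semialgebraic cell. [bookkeeping] -/
theorem isSemialgebraic_cell (e : Fin (a + b) ≃ Fin (a + b)) : IsSemialgebraic ℚ (cell e) :=
  (KZ.isSemialgebraic_openOrderedSimplex (a + b)).preimage_comp e

/-- Auxiliary step `cell_subset_prodDomain`: cell subset prod Domain. [bookkeeping] -/
theorem cell_subset_prodDomain (r : KZ.IntegralRep a) (s : KZ.IntegralRep b)
    (hr : r.domain = KZ.openOrderedSimplex a) (hs : s.domain = KZ.openOrderedSimplex b)
    {e : Fin (a + b) ≃ Fin (a + b)} (he : IsShuffle a b e) :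
    cell e ⊆ (r.prod s).domain := by
  intro z hz
  rw [KZ.IntegralRep.prod_domain, KZ.IntegralRep.mem_prodDomain, hr, hs]
  exact mem_simplex_of_comp_mem_simplex he hz

/-- the piece of the product representation on the cell of `e` -/
def piece (r : KZ.IntegralRep a) (s : KZ.IntegralRep b)
    (hr : r.domain = KZ.openOrderedSimplex a) (hs : s.domain = KZ.openOrderedSimplex b)
    {e : Fin (a + b) ≃ Fin (a + b)} (he : IsShuffle a b e) : KZ.IntegralRep (a + b) :=
  (r.prod s).restrict (cell e) (isSemialgebraic_cell e) (cell_subset_prodDomain r s hr hs he)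

/-- the SHUFFLED representation on `Δ_{a+b}`: the piece read along `e` (a genuine `IntegralRep`, by `reindex`) -/
def shuffled (r : KZ.IntegralRep a) (s : KZ.IntegralRep b)
    (hr : r.domain = KZ.openOrderedSimplex a) (hs : s.domain = KZ.openOrderedSimplex b)
    {e : Fin (a + b) ≃ Fin (a + b)} (he : IsShuffle a b e) : KZ.IntegralRep (a + b) :=
  (piece r s hr hs he).reindex e.symm

variable {r : KZ.IntegralRep a} {s : KZ.IntegralRep b}
  {hr : r.domain = KZ.openOrderedSimplex a} {hs : s.domain = KZ.openOrderedSimplex b}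

/-- Auxiliary step `shuffled_domain`: shuffled domain. [bookkeeping] -/
theorem shuffled_domain {e : Fin (a + b) ≃ Fin (a + b)} (he : IsShuffle a b e) :
    (shuffled r s hr hs he).domain = KZ.openOrderedSimplex (a + b) := by
  ext u
  simp only [shuffled, piece, cell, KZ.IntegralRep.reindex_domain, KZ.IntegralRep.domain_restrict,
    Equiv.symm_apply_apply, mem_setOf_eq]

/-- Auxiliary step `shuffled_integrand`: shuffled integrand. [bookkeeping] -/
theorem shuffled_integrand {e : Fin (a + b) ≃ Fin (a + b)} (he : IsShuffle a b e) (u : Fin (a + b) → ℝ) :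
    (shuffled r s hr hs he).integrand u =
      r.integrand (fun i => u (e.symm (Fin.castAdd b i))) * s.integrand (fun j => u (e.symm (Fin.natAdd a j))) := by
  simp only [shuffled, piece, KZ.IntegralRep.reindex_integrand, KZ.IntegralRep.integrand_restrict,
    KZ.IntegralRep.prod_integrand_eq, KZ.IntegralRep.prodFun_apply]

/-- Auxiliary step `piece_sub_shuffled`: piece sub shuffled. [bookkeeping] -/
theorem piece_sub_shuffled {e : Fin (a + b) ≃ Fin (a + b)} (he : IsShuffle a b e) :
    KZ.of (piece r s hr hs he) - KZ.of (shuffled r s hr hs he) ∈ KZ.relations :=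
  KZ.of_sub_of_reindex_mem_relations _ _

/-- **rule (1a): the product is the sum of its shuffle pieces** -/
theorem of_prod_sub_sum_pieces {N : ℕ} (e : Fin N → (Fin (a + b) ≃ Fin (a + b)))
    (hmem : ∀ i, IsShuffle a b (e i)) (hinj : ∀ i j, List.ofFn (e i) = List.ofFn (e j) → i = j)
    (hsurj : ∀ w ∈ MZV.shuffleWord (List.ofFn (Fin.castAdd b : Fin a → Fin (a + b))) (List.ofFn (Fin.natAdd a)),
      ∃ i, List.ofFn (e i) = w) :
    KZ.of (r.prod s) - ∑ i, KZ.of (piece r s hr hs (hmem i)) ∈ KZ.relations := by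
  refine KZ.of_sub_sum_of_mem_relations_of_subset Finset.univ _ (fun i => piece r s hr hs (hmem i))
    (fun i _ => cell_subset_prodDomain r s hr hs (hmem i)) (fun i _ z _ => rfl) ?_ ?_
  · -- cover off the null walls
    refine measure_mono_null (fun z hz => ?_)
      (measure_iUnion_null_iff.2 fun i : Fin a => measure_iUnion_null_iff.2 fun j : Fin b =>
        KZ.volume_setOf_apply_eq_apply (n := a + b) (i := Fin.castAdd b i) (j := Fin.natAdd a j)
          fun h => absurd (congrArg Fin.val h) (by simp; omega))
    rw [Set.mem_sdiff, KZ.IntegralRep.prod_domain, KZ.IntegralRep.mem_prodDomain, hr, hs] at hz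
    obtain ⟨⟨hx, hy⟩, hz⟩ := hz
    by_contra hne
    simp only [mem_iUnion, mem_setOf_eq, not_exists] at hne
    obtain ⟨e₀, he₀, hz₀⟩ := exists_comp_mem_simplex hx hy hne
    obtain ⟨i, hi⟩ := hsurj _ he₀
    have hei : e i = e₀ := Equiv.ext (congrFun (List.ofFn_injective hi))
    refine hz (mem_iUnion₂.2 ⟨i, Finset.mem_univ _, ?_⟩)
    show (fun k => z (e i k)) ∈ KZ.openOrderedSimplex (a + b)
    rw [hei]
    exact hz₀
  · -- pairwise disjoint
    intro i _ j _ hij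
    refine Set.disjoint_left.2 fun z hzi hzj => hij (hinj i j ?_)
    exact ofFn_eq_of_comp_mem_simplex hzi hzj

/-! ## 3  Word representations: the shuffled integrand is the merged word -/

/-- the Kontsevich word form `q · ∏ ω_{εᵢ}(tᵢ)` (`ω₀ = dt/t`, `ω₁ = dt/(1-t)`) -/
def wordFun (ε : Fin k → Bool) (q : ℚ) (t : Fin k → ℝ) : ℝ :=
  (q : ℝ) * ∏ i, if ε i then 1 / (1 - t i) else 1 / t i

/-- top-weight words of dimension `k` (the `w = k` stratum of `words k`) -/
def topWords (k : ℕ) : Set KZ.FormalRep :=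
  {x | ∃ (ε : Fin k → Bool) (q : ℚ) (s : KZ.IntegralRep k), s.domain = simplex k ∧
    EqOn s.integrand (fun t => (q : ℝ) * ∏ i, if ε i then 1 / (1 - t i) else 1 / t i) s.domain ∧ x = KZ.of s}

/-- Auxiliary step `topWords_subset_words`: top Words subset words. [bookkeeping] -/
theorem topWords_subset_words (k : ℕ) : topWords k ⊆ words k :=
  fun _ ⟨ε, q, s, hd, hi, hx⟩ => ⟨k, ε, q, s, le_rfl, hd, hi, hx⟩

/-- Auxiliary step `shuffled_word`: shuffled word. [bookkeeping] -/
theorem shuffled_word (ε : Fin a → Bool) (ε' : Fin b → Bool) (q q' : ℚ)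
    (hri : EqOn r.integrand (wordFun ε q) r.domain) (hsi : EqOn s.integrand (wordFun ε' q') s.domain)
    {e : Fin (a + b) ≃ Fin (a + b)} (he : IsShuffle a b e) :
    EqOn (shuffled r s hr hs he).integrand (wordFun (fun l => Fin.append ε ε' (e l)) (q * q'))
      (shuffled r s hr hs he).domain := by
  intro u hu
  rw [shuffled_domain] at hu
  have hcell : (fun k => (fun m => u (e.symm m)) (e k)) ∈ KZ.openOrderedSimplex (a + b) := by
    simpa using hu
  obtain ⟨hx, hy⟩ := mem_simplex_of_comp_mem_simplex (z := fun m => u (e.symm m)) he hcell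
  rw [shuffled_integrand, hri (by rw [hr]; exact hx), hsi (by rw [hs]; exact hy)]
  have key : ((∏ i : Fin a, if ε i then 1 / (1 - u (e.symm (Fin.castAdd b i))) else 1 / u (e.symm (Fin.castAdd b i))) *
      ∏ j : Fin b, if ε' j then 1 / (1 - u (e.symm (Fin.natAdd a j))) else 1 / u (e.symm (Fin.natAdd a j))) =
      ∏ l : Fin (a + b), if Fin.append ε ε' (e l) then 1 / (1 - u l) else 1 / u l := by
    have h1 : (∏ m : Fin (a + b), if Fin.append ε ε' m then 1 / (1 - u (e.symm m)) else 1 / u (e.symm m)) =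
        (∏ i : Fin a, if ε i then 1 / (1 - u (e.symm (Fin.castAdd b i))) else 1 / u (e.symm (Fin.castAdd b i))) *
          ∏ j : Fin b, if ε' j then 1 / (1 - u (e.symm (Fin.natAdd a j))) else 1 / u (e.symm (Fin.natAdd a j)) := by
      rw [Fin.prod_univ_add]
      simp only [Fin.append_left, Fin.append_right]
    rw [← h1, ← Equiv.prod_comp e (fun m => if Fin.append ε ε' m then 1 / (1 - u (e.symm m)) else 1 / u (e.symm m))]
    simp only [Equiv.symm_apply_apply]
  simp only [wordFun]
  rw [← key]
  push_cast
  ring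

/-- Auxiliary step `shuffled_mem_topWords`: shuffled mem top Words. [bookkeeping] -/
theorem shuffled_mem_topWords (ε : Fin a → Bool) (ε' : Fin b → Bool) (q q' : ℚ)
    (hri : EqOn r.integrand (wordFun ε q) r.domain) (hsi : EqOn s.integrand (wordFun ε' q') s.domain)
    {e : Fin (a + b) ≃ Fin (a + b)} (he : IsShuffle a b e) :
    KZ.of (shuffled r s hr hs he) ∈ topWords (a + b) :=
  ⟨fun l => Fin.append ε ε' (e l), q * q', _, shuffled_domain he, fun u hu => by
    have := shuffled_word ε ε' q q' hri hsi he hu; simpa only [wordFun, Rat.cast_mul] using this, rfl⟩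

/-! ## 4  THE SHUFFLE PRODUCT AS KZ MOVES -/

/-- **SHUFFLE PRODUCT, representation form**: `[Δ_a, qω_ε]·[Δ_b, q'ω_ε'] ≡ Σ_e [Δ_{a+b}, qq' ω_{(ε⧺ε')∘e}]`. -/
theorem word_mul_word_rel (r : KZ.IntegralRep a) (s : KZ.IntegralRep b)
    (hr : r.domain = KZ.openOrderedSimplex a) (hs : s.domain = KZ.openOrderedSimplex b)
    (ε : Fin a → Bool) (ε' : Fin b → Bool) (q q' : ℚ)
    (hri : EqOn r.integrand (wordFun ε q) r.domain) (hsi : EqOn s.integrand (wordFun ε' q') s.domain) :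
    ∃ (N : ℕ) (W : Fin N → KZ.IntegralRep (a + b)),
      (∀ i, KZ.of (W i) ∈ topWords (a + b)) ∧ KZ.of r * KZ.of s - ∑ i, KZ.of (W i) ∈ KZ.relations := by
  obtain ⟨N, e, hmem, hinj, hsurj⟩ := KZ.exists_enum_coordShuffles a b
  refine ⟨N, fun i => shuffled r s hr hs (hmem i), fun i => shuffled_mem_topWords ε ε' q q' hri hsi (hmem i), ?_⟩
  rw [KZ.of_mul_of]
  have h1 := of_prod_sub_sum_pieces (r := r) (s := s) (hr := hr) (hs := hs) e hmem hinj hsurj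
  have h2 : ∑ i, (KZ.of (piece r s hr hs (hmem i)) - KZ.of (shuffled r s hr hs (hmem i))) ∈ KZ.relations :=
    sum_mem fun i _ => piece_sub_shuffled (hmem i)
  rw [Finset.sum_sub_distrib] at h2
  convert KZ.relations.add_mem h1 h2 using 1
  abel

/-- Auxiliary step `congInto_mono`: cong Into mono. [bookkeeping] -/
private theorem congInto_mono {S T : Set KZ.FormalRep} (h : S ⊆ T) {x : KZ.FormalRep} (hx : CongInto S x) : CongInto T x := by
  obtain ⟨m, hm, hx⟩ := hx
  exact ⟨m, AddSubgroup.closure_mono h hm, hx⟩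

/-- **SHUFFLE PRODUCT, class form**: a product of two top-weight words is congruent to a sum of
top-weight words of the total weight. -/
theorem congInto_topWords_mul {x y : KZ.FormalRep} (hx : x ∈ topWords a) (hy : y ∈ topWords b) :
    CongInto (topWords (a + b)) (x * y) := by
  obtain ⟨ε, q, r, hr, hri, rfl⟩ := hx
  obtain ⟨ε', q', s, hs, hsi, rfl⟩ := hy
  obtain ⟨N, W, hW, hrel⟩ := word_mul_word_rel r s hr hs ε ε' q q' hri hsi
  exact ⟨∑ i, KZ.of (W i), sum_mem fun i _ => AddSubgroup.subset_closure (hW i), hrel⟩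

/-- Auxiliary step `congInto_words_mul`: cong Into words mul. [bookkeeping] -/
theorem congInto_words_mul {x y : KZ.FormalRep} (hx : x ∈ topWords a) (hy : y ∈ topWords b) :
    CongInto (words (a + b)) (x * y) :=
  congInto_mono (topWords_subset_words (a + b)) (congInto_topWords_mul hx hy)

/-- the rung-4 instances: `ζ-words of weight 2 × weight 2` and `1 × 3`, `3 × 1` land in `words 4` -/
theorem congInto_words_four_of_two_two {x y : KZ.FormalRep} (hx : x ∈ topWords 2) (hy : y ∈ topWords 2) :
    CongInto (words 4) (x * y) := by
  simpa using congInto_words_mul hx hy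

/-- Auxiliary step `congInto_words_four_of_one_three`: cong Into words four of one three. [bookkeeping] -/
theorem congInto_words_four_of_one_three {x y : KZ.FormalRep} (hx : x ∈ topWords 1) (hy : y ∈ topWords 3) :
    CongInto (words 4) (x * y) := by
  simpa using congInto_words_mul hx hy

/-- Auxiliary step `congInto_words_four_of_three_one`: cong Into words four of three one. [bookkeeping] -/
theorem congInto_words_four_of_three_one {x y : KZ.FormalRep} (hx : x ∈ topWords 3) (hy : y ∈ topWords 1) :
    CongInto (words 4) (x * y) := by
  simpa using congInto_words_mul hx hy

end Summit.KontsevichZagierPeriods.KontsevichZagierPeriods.Cruxes.GZNormalFormWThree.GZLadder.Shuffle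

namespace Summit.KontsevichZagierPeriods.KontsevichZagierPeriods.Cruxes.GZNormalFormWThree.GZLadder.ProdFour

open Set MeasureTheory MvPolynomial
open Literature.NumberTheory.Transcendental
open Literature.ModelTheory.ExponentialFields

/-! ## 1  A generic rule-(2) lemma and small tools -/

/-- **rule (2) along a chart, user form**: a chart `Φ` on `r.domain` with derivative `L`, injective, with
`|det L p| = jac p`, transports `[r.domain, (g ∘ Φ)·jac] ≡ [Φ '' r.domain, g]`. -/
theorem chart_rel {n : ℕ} {Φ : (Fin n → ℝ) → (Fin n → ℝ)} {L : (Fin n → ℝ) → ((Fin n → ℝ) →L[ℝ] (Fin n → ℝ))}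
    {jac : (Fin n → ℝ) → ℝ} (r r' : KZ.IntegralRep n)
    (hsa : IsSemialgebraicMapOn ℚ r.domain Φ) (hder : ∀ p, HasFDerivAt Φ (L p) p) (hinj : InjOn Φ r.domain)
    (hdet : ∀ p ∈ r.domain, |(L p).det| = jac p) (hdom : r'.domain = Φ '' r.domain)
    (h : ∀ p ∈ r.domain, r.integrand p = r'.integrand (Φ p) * jac p) :
    KZ.of r - KZ.of r' ∈ KZ.relations :=
  KZ.changeOfVariablesRel_subset_relations ⟨n, r, r', Φ, L, hsa,
    fun x _ => (hder x).hasFDerivWithinAt, hinj, hdom, fun p hp => by rw [hdet p hp]; exact h p hp, rfl⟩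

/-- Auxiliary step `mem_Δ4`: mem Δ4. [bookkeeping] -/
private theorem mem_Δ4 (t : Fin 4 → ℝ) :
    t ∈ KZ.openOrderedSimplex 4 ↔ 0 < t 3 ∧ t 3 < t 2 ∧ t 2 < t 1 ∧ t 1 < t 0 ∧ t 0 < 1 := by
  constructor
  · rintro ⟨h0, h1, ha⟩
    exact ⟨h0 3, ha (show (2 : Fin 4) < 3 by decide), ha (show (1 : Fin 4) < 2 by decide),
      ha (show (0 : Fin 4) < 1 by decide), h1 0⟩
  · rintro ⟨h3, h32, h21, h10, h0⟩
    have hsa : StrictAnti t := by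
      refine Fin.strictAnti_iff_succ_lt.mpr fun i => ?_
      fin_cases i
      · simpa using h10
      · simpa using h21
      · simpa using h32
    exact ⟨fun i => lt_of_lt_of_le h3 (hsa.antitone (Fin.le_last i)),
      fun i => lt_of_le_of_lt (hsa.antitone (Fin.le_iff_val_le_val.2 (Nat.zero_le _))) h0, hsa⟩

/-- Auxiliary step `isSemialgebraic_pos4`: is Semialgebraic pos4. [bookkeeping] -/
private theorem isSemialgebraic_pos4 (q : MvPolynomial (Fin 4) ℚ) :
    IsSemialgebraic ℚ {p : Fin 4 → ℝ | 0 < MvPolynomial.aeval p q} :=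
  Literature.ModelTheory.ExponentialFields.isSemialgebraic_setOf_eval_pos (k := ℚ) q

/-- coordinate projections -/
abbrev Pj (i : Fin 4) : (Fin 4 → ℝ) →L[ℝ] ℝ :=
  ContinuousLinearMap.proj (R := ℝ) (φ := fun _ : Fin 4 => ℝ) i

/-- Auxiliary step `hasFDerivAt_coord`: has FDeriv At coord. [bookkeeping] -/
theorem hasFDerivAt_coord (i : Fin 4) (p : Fin 4 → ℝ) :
    HasFDerivAt (fun q : Fin 4 → ℝ => q i) (Pj i) p := hasFDerivAt_apply (𝕜 := ℝ) i p

/-- `D(q ↦ q i * q j)` at `p` in the shape produced by `HasFDerivAt.mul` -/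
def d2 (p : Fin 4 → ℝ) (i j : Fin 4) : (Fin 4 → ℝ) →L[ℝ] ℝ := p i • Pj j + p j • Pj i

/-- Auxiliary step `hasFDerivAt_d2`: has FDeriv At d2. [bookkeeping] -/
theorem hasFDerivAt_d2 (p : Fin 4 → ℝ) (i j : Fin 4) :
    HasFDerivAt (fun q : Fin 4 → ℝ => q i * q j) (d2 p i j) p :=
  (hasFDerivAt_coord i p).mul (hasFDerivAt_coord j p)

/-- Auxiliary step `d2_apply`: d2 apply. [bookkeeping] -/
theorem d2_apply (p h : Fin 4 → ℝ) (i j : Fin 4) : d2 p i j h = p i * h j + p j * h i := by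
  simp [d2]

/-! ## 2  `Φ₂₂ : Δ₂ × Δ₂ → Δ₄`, `(a₀,a₁,b₀,b₁) ↦ (a₀, a₁, a₁b₀, a₁b₁)` -/

/-- `Δ₂ × Δ₂` in the coordinates `(a₀, a₁, b₀, b₁)` -/
def dom22 : Set (Fin 4 → ℝ) := {p | p 1 < p 0 ∧ p 0 < 1 ∧ 0 < p 1 ∧ p 3 < p 2 ∧ p 2 < 1 ∧ 0 < p 3}

/-- Auxiliary step `mem_dom22_iff`: mem dom22 iff. [bookkeeping] -/
theorem mem_dom22_iff (p : Fin 4 → ℝ) :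
    p ∈ dom22 ↔ p 1 < p 0 ∧ p 0 < 1 ∧ 0 < p 1 ∧ p 3 < p 2 ∧ p 2 < 1 ∧ 0 < p 3 := Iff.rfl

/-- Auxiliary step `isSemialgebraic_dom22`: is Semialgebraic dom22. [bookkeeping] -/
theorem isSemialgebraic_dom22 : IsSemialgebraic ℚ dom22 := by
  have e : dom22 =
      ((((({p : Fin 4 → ℝ | 0 < MvPolynomial.aeval p (X 0 - X 1 : MvPolynomial (Fin 4) ℚ)} ∩
        {p | 0 < MvPolynomial.aeval p (C 1 - X 0 : MvPolynomial (Fin 4) ℚ)}) ∩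
        {p | 0 < MvPolynomial.aeval p (X 1 : MvPolynomial (Fin 4) ℚ)}) ∩
        {p | 0 < MvPolynomial.aeval p (X 2 - X 3 : MvPolynomial (Fin 4) ℚ)}) ∩
        {p | 0 < MvPolynomial.aeval p (C 1 - X 2 : MvPolynomial (Fin 4) ℚ)}) ∩
        {p | 0 < MvPolynomial.aeval p (X 3 : MvPolynomial (Fin 4) ℚ)}) := by
    ext p
    simp only [mem_dom22_iff, Set.mem_inter_iff, Set.mem_setOf_eq, map_sub, MvPolynomial.aeval_X, map_one,
      sub_pos]
    tauto
  rw [e]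
  exact (((((isSemialgebraic_pos4 _).inter (isSemialgebraic_pos4 _)).inter (isSemialgebraic_pos4 _)).inter
    (isSemialgebraic_pos4 _)).inter (isSemialgebraic_pos4 _)).inter (isSemialgebraic_pos4 _)

/-- Auxiliary definition `map22`: map22. [bookkeeping] -/
def map22 (p : Fin 4 → ℝ) : Fin 4 → ℝ := ![p 0, p 1, p 1 * p 2, p 1 * p 3]

/-- Auxiliary step `map22_zero`: map22 zero. [bookkeeping] -/
theorem map22_zero (p : Fin 4 → ℝ) : map22 p 0 = p 0 := rfl
/-- Auxiliary step `map22_one`: map22 one. [bookkeeping] -/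
theorem map22_one (p : Fin 4 → ℝ) : map22 p 1 = p 1 := rfl
/-- Auxiliary step `map22_two`: map22 two. [bookkeeping] -/
theorem map22_two (p : Fin 4 → ℝ) : map22 p 2 = p 1 * p 2 := rfl
/-- Auxiliary step `map22_three`: map22 three. [bookkeeping] -/
theorem map22_three (p : Fin 4 → ℝ) : map22 p 3 = p 1 * p 3 := rfl

/-- Auxiliary definition `inv22`: inv22. [bookkeeping] -/
def inv22 (t : Fin 4 → ℝ) : Fin 4 → ℝ := ![t 0, t 1, t 2 / t 1, t 3 / t 1]

/-- Auxiliary step `map22_mem`: map22 mem. [bookkeeping] -/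
theorem map22_mem {p : Fin 4 → ℝ} (hp : p ∈ dom22) : map22 p ∈ KZ.openOrderedSimplex 4 := by
  obtain ⟨h10, h0, h1, h32, h2, h3⟩ := hp
  rw [mem_Δ4, map22_zero, map22_one, map22_two, map22_three]
  refine ⟨mul_pos h1 h3, mul_lt_mul_of_pos_left h32 h1, ?_, h10, h0⟩
  calc p 1 * p 2 < p 1 * 1 := mul_lt_mul_of_pos_left h2 h1
    _ = p 1 := mul_one _

/-- Auxiliary step `inv22_mem`: inv22 mem. [bookkeeping] -/
theorem inv22_mem {t : Fin 4 → ℝ} (ht : t ∈ KZ.openOrderedSimplex 4) : inv22 t ∈ dom22 := by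
  obtain ⟨h3, h32, h21, h10, h0⟩ := (mem_Δ4 t).1 ht
  have h1 : 0 < t 1 := by linarith
  simp only [mem_dom22_iff, inv22, Matrix.cons_val_zero, Matrix.cons_val_one, Matrix.head_cons,
    Matrix.cons_val_two, Matrix.tail_cons, Matrix.cons_val_three]
  refine ⟨h10, h0, h1, div_lt_div_of_pos_right h32 h1, by rw [div_lt_one h1]; exact h21, div_pos h3 h1⟩

/-- Auxiliary step `map22_inv22`: map22 inv22. [bookkeeping] -/
theorem map22_inv22 {t : Fin 4 → ℝ} (ht : t ∈ KZ.openOrderedSimplex 4) : map22 (inv22 t) = t := by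
  obtain ⟨h3, h32, h21, h10, h0⟩ := (mem_Δ4 t).1 ht
  have h1 : t 1 ≠ 0 := by linarith
  funext i
  fin_cases i
  · simp [map22, inv22]
  · simp [map22, inv22]
  · simp [map22, inv22]; field_simp
  · simp [map22, inv22]; field_simp

/-- Auxiliary step `inv22_map22`: inv22 map22. [bookkeeping] -/
theorem inv22_map22 {p : Fin 4 → ℝ} (hp : p ∈ dom22) : inv22 (map22 p) = p := by
  have h1 : p 1 ≠ 0 := hp.2.2.1.ne'
  funext i
  fin_cases i
  · simp [map22, inv22]
  · simp [map22, inv22]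
  · simp [map22, inv22]; field_simp
  · simp [map22, inv22]; field_simp

/-- Auxiliary step `image_map22`: image map22. [bookkeeping] -/
theorem image_map22 : map22 '' dom22 = KZ.openOrderedSimplex 4 := by
  ext t
  constructor
  · rintro ⟨p, hp, rfl⟩; exact map22_mem hp
  · intro ht; exact ⟨inv22 t, inv22_mem ht, map22_inv22 ht⟩

/-- Auxiliary step `injOn_map22`: inj On map22. [bookkeeping] -/
theorem injOn_map22 : InjOn map22 dom22 :=
  fun p hp q hq h => by rw [← inv22_map22 hp, ← inv22_map22 hq, h]

/-- Auxiliary step `isSemialgebraicMapOn_map22`: is Semialgebraic Map On map22. [bookkeeping] -/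
theorem isSemialgebraicMapOn_map22 : IsSemialgebraicMapOn ℚ dom22 map22 :=
  (isSemialgebraicMapOn_aeval isSemialgebraic_dom22
    ![X 0, X 1, X 1 * X 2, (X 1 * X 3 : MvPolynomial (Fin 4) ℚ)]).congr
    fun p _ => by
      funext j
      fin_cases j <;> simp [map22_zero, map22_one, map22_two, map22_three]

/-- Auxiliary definition `row22`: row22. [bookkeeping] -/
def row22 (p : Fin 4 → ℝ) : Fin 4 → ((Fin 4 → ℝ) →L[ℝ] ℝ) := ![Pj 0, Pj 1, d2 p 1 2, d2 p 1 3]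

/-- Auxiliary definition `L22`: L22. [bookkeeping] -/
def L22 (p : Fin 4 → ℝ) : (Fin 4 → ℝ) →L[ℝ] (Fin 4 → ℝ) := ContinuousLinearMap.pi (row22 p)

/-- Auxiliary step `L22_apply`: L22 apply. [bookkeeping] -/
theorem L22_apply (p h : Fin 4 → ℝ) (i : Fin 4) : L22 p h i = row22 p i h := rfl

/-- Auxiliary step `hasFDerivAt_map22`: has FDeriv At map22. [bookkeeping] -/
theorem hasFDerivAt_map22 (p : Fin 4 → ℝ) : HasFDerivAt map22 (L22 p) p := by
  have key : HasFDerivAt (fun q : Fin 4 → ℝ => fun i => (![q 0, q 1, q 1 * q 2, q 1 * q 3] :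
      Fin 4 → ℝ) i) (ContinuousLinearMap.pi (row22 p)) p := by
    refine hasFDerivAt_pi.2 fun i => ?_
    fin_cases i
    · simpa [row22] using hasFDerivAt_coord 0 p
    · simpa [row22] using hasFDerivAt_coord 1 p
    · simpa [row22] using hasFDerivAt_d2 p 1 2
    · simpa [row22] using hasFDerivAt_d2 p 1 3
  exact key

/-- Auxiliary definition `M22`: M22. [bookkeeping] -/
def M22 (p : Fin 4 → ℝ) : Matrix (Fin 4) (Fin 4) ℝ :=
  !![1, 0, 0, 0; 0, 1, 0, 0; 0, p 2, p 1, 0; 0, p 3, 0, p 1]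

end Summit.KontsevichZagierPeriods.KontsevichZagierPeriods.Cruxes.GZNormalFormWThree.GZLadder.ProdFour
end
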